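import Summits.QuantumFields.YangMills.Theorems.UnitScaleTiltProp7LocalModelAverage
import Summits.QuantumFields.YangMills.Theorems.UnitScaleTiltProp7LemmaHCurvedOfLocalModelsPt
import HarnessLib

/-!
# Route `UnitScaleTilt`, crux K1 «MinimiserStabilityRegPr» (stmt-QuantumFields-19200), route-R E′ path (α′), S3 K-form engine, rows (R4′)∕(H) — FILE 9p₃ (T³ letters):
# LEMMA-H-CURVED AT AVERAGED ∕ AXIAL FAMILIES, POINTWISE RECENTRING GROUP — ✓p671704 `lemmaH_curved_of_localModels_avg` ∕ `lemmaH_curved_comb_avg` RESHAPED (routeR-w1 LOCATE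
# (J-δV)(d), 2026-08-28 23:16Z): `(G, hG)` removed; third group `3·(d·(24∕ℓ²)²)·Σ_y Σ_(z : N y z) Σ_μ ‖Ψ̄_y(z) − Z_μ(z)‖²` with `Ψ̄_y(z) = |H|⁻¹Σ_η Ψ^η_y(z)` resp.
# `|H|⁻¹Σ_η R(axialT 𝒲 c^η_y z)⁻¹ m^η_y` DISPLAYED (sum-type, bookable); Laplacian and Dirichlet groups VERBATIM.

Cell `ym3-torus`, D-0154 (3c) twin-width seat `ym-routeR-w1` (gen 6); standing PASS R4′ (★p1 g16 23:01Z).  THEOREMS ONLY (0 `def`, 0 `sorry`); `--supports stmt-QuantumFields-19200`,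
count-neutral.  YM₃ on T³ is a ladder rung (R3), not the Clay problem; nothing here claims a stub, the crux, d = 4 or the gap.

WHAT (ns `…Theorems.Prop7LocalModelAveragePt`): ★★★ `lemmaH_curved_of_localModels_avg_pt`, ★★★ `lemmaH_curved_comb_avg_pt` (✓ `lemmaH_curved_of_localModels_pt` + ✓p671704's convexity lemmas).
HONEST SCOPE.  As ✓p671704; no estimate of the groups.

References: T. Bałaban, CMP 99 (1985) 389–434 [Balaban1985BackgroundPropagators] ((3.3) p.390, (3.8) p.392, Thm 3.11 p.416); CMP 95 (1984) 17–40 [Balaban1984PropagatorsI]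
((1.29)–(1.31) p.23); CMP 102 (1985) 255–275 [Balaban1985UV3] ((27) p.263).
-/

set_option autoImplicit false

noncomputable section

open scoped BigOperators Matrix.Norms.L2Operator Matrix

namespace Summit.QuantumFields.YangMills.Theorems.Prop7LocalModelAveragePt

open Literature.MathematicalPhysics.QuantumFieldTheory.Balaban1983to89
open Literature.MathematicalPhysics.QuantumFieldTheory.Balaban1983to89.T3ContinuumYM3Torus
open B9Eq39Adjoint (R covD covDstar divB)
open B9TorusCalculus (torusT)
open B10Eq27TorusAxialLog (unitsField toUField holT axialT contourT rel)
open B5Eq118OneStroke (iterBlockOf)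
open B15DeterminingSets (embIter)
open Summit.QuantumFields.YangMills.Theorems.Prop7HermiteCornerBlendCov (covD_finset_sum covDstar_finset_sum divB_covD_finset_sum)
open Summit.QuantumFields.YangMills.Theorems.Prop7ConjFrameTransport (covD_smul_fun covDstar_smul_fun divB_covD_smul_fun)
open Summit.QuantumFields.YangMills.Theorems.Prop7HermiteCornerBlendEnergy (jensen_sq)
open Summit.QuantumFields.YangMills.Theorems.Prop7CovHodgeSplit (unitsField_toUField_mem_unitary)
open Summit.QuantumFields.YangMills.Theorems.Prop7LemmaHCurvedOfRows (bicontr_of_mem_unitary)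
open Summit.QuantumFields.YangMills.Theorems.Prop7LemmaHCurvedOfLocalModelsPt (lemmaH_curved_of_localModels_pt)
open Summit.QuantumFields.YangMills.Theorems.Prop7LocalModelAverage (norm_sq_lap_avg_le norm_sq_covD_avg_le norm_sq_covDstar_avg_le)
open Summit.QuantumFields.YangMills.Theorems.Prop7AxialLocalModel (norm_covD_axialModel_le norm_covDstar_axialModel_le norm_lap_axialModel_le)

/-! ## §1 Averaged families -/

section T3

variable {H : Type*} [Fintype H] [Nonempty H]

/-- ★★★ **LEMMA-H-CURVED, AVERAGED LOCAL MODELS, POINTWISE RECENTRING GROUP** (✓ `lemmaH_curved_of_localModels_avg` reshaped: no `G`∕`hG`; third group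
`3·(d·(24∕ℓ²)²)·Σ_yΣ_(z:N)Σ_μ‖|H|⁻¹Σ_η Ψ^η_y(z) − Z_μ z‖²`). [cite: Balaban1985BackgroundPropagators, (3.3)-(3.4) pp.390-391, Thm 3.11 p.416; Balaban1984PropagatorsI, (1.29)-(1.31) p.23] -/
theorem lemmaH_curved_of_localModels_avg_pt (F : T3Family) (K n : ℕ) (hk : K - n ≤ (F.P K).m + (F.P K).K) (hℓ2 : 2 ≤ (F.P K).L ^ (K - n))
    (W : GaugeField (F.P K) 0 (Matrix.specialUnitaryGroup (Fin 2) ℂ)) (ψ : Site (F.P K) 0 → Matrix (Fin 2) (Fin 2) ℂ)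
    (hψ : ∀ x : Site (F.P K) 0, x ∉ Set.range (embIter (K - n)) →
      divB (torusT (F.P K) 0) (fun κ z => unitsField (toUField W) ⟨z, κ⟩) (fun κ y => covD (torusT (F.P K) 0) (fun κ z => unitsField (toUField W) ⟨z, κ⟩) κ
        (fun z => divB (torusT (F.P K) 0) (fun κ z => unitsField (toUField W) ⟨z, κ⟩)
          (fun ν w => covD (torusT (F.P K) 0) (fun κ z => unitsField (toUField W) ⟨z, κ⟩) ν ψ w) z) y) x = 0)
    (Ψ : H → Site (F.P K) (K - n) → Site (F.P K) 0 → Matrix (Fin 2) (Fin 2) ℂ) (hΨ : ∀ η y, Ψ η y (embIter (K - n) y) = ψ (embIter (K - n) y))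
    (Z : Fin (F.P K).d → Site (F.P K) 0 → Matrix (Fin 2) (Fin 2) ℂ) :
    (F.L : ℝ) ^ (K - n) * ∑ x : Site (F.P K) 0, ∑ a : Fin 2, ∑ b : Fin 2,
        Complex.normSq ((divB (torusT (F.P K) 0) (fun κ z => unitsField (toUField W) ⟨z, κ⟩)
          (fun κ y => covD (torusT (F.P K) 0) (fun κ z => unitsField (toUField W) ⟨z, κ⟩) κ ψ y) x) a b)
      ≤ (F.L : ℝ) ^ (K - n) * (2 * (
          3 * ∑ y : Site (F.P K) (K - n), ∑ z : Site (F.P K) 0,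
            (if (∀ ν : Fin (F.P K).d,
                (y ν = (iterBlockOf (K - n) (fun κ => z κ - (((((F.P K).L ^ (K - n) - 1) / 2 : ℕ)) : ZMod ((F.P K).sitesPerDir 0)))) ν - 1
                ∨ y ν = (iterBlockOf (K - n) (fun κ => z κ - (((((F.P K).L ^ (K - n) - 1) / 2 : ℕ)) : ZMod ((F.P K).sitesPerDir 0)))) ν
                ∨ y ν = (iterBlockOf (K - n) (fun κ => z κ - (((((F.P K).L ^ (K - n) - 1) / 2 : ℕ)) : ZMod ((F.P K).sitesPerDir 0)))) ν + 1
                ∨ y ν = (iterBlockOf (K - n) (fun κ => z κ - (((((F.P K).L ^ (K - n) - 1) / 2 : ℕ)) : ZMod ((F.P K).sitesPerDir 0)))) ν + 2))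
              then (Fintype.card H : ℝ)⁻¹ * ∑ η, ‖divB (torusT (F.P K) 0) (fun κ z => unitsField (toUField W) ⟨z, κ⟩)
                (fun μ => covD (torusT (F.P K) 0) (fun κ z => unitsField (toUField W) ⟨z, κ⟩) μ (Ψ η y)) z‖ ^ 2 else 0)
          + 3 * (2 * ((F.P K).d : ℝ) * (6 / ((((F.P K).L ^ (K - n) : ℕ) : ℝ)))) * (3 / ((((F.P K).L ^ (K - n) : ℕ) : ℝ)))
            * ∑ y : Site (F.P K) (K - n), ∑ z : Site (F.P K) 0,
              (if (∀ ν : Fin (F.P K).d,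
                  (y ν = (iterBlockOf (K - n) (fun κ => z κ - (((((F.P K).L ^ (K - n) - 1) / 2 : ℕ)) : ZMod ((F.P K).sitesPerDir 0)))) ν - 1
                  ∨ y ν = (iterBlockOf (K - n) (fun κ => z κ - (((((F.P K).L ^ (K - n) - 1) / 2 : ℕ)) : ZMod ((F.P K).sitesPerDir 0)))) ν
                  ∨ y ν = (iterBlockOf (K - n) (fun κ => z κ - (((((F.P K).L ^ (K - n) - 1) / 2 : ℕ)) : ZMod ((F.P K).sitesPerDir 0)))) ν + 1
                  ∨ y ν = (iterBlockOf (K - n) (fun κ => z κ - (((((F.P K).L ^ (K - n) - 1) / 2 : ℕ)) : ZMod ((F.P K).sitesPerDir 0)))) ν + 2))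
                then ∑ μ : Fin (F.P K).d, (Fintype.card H : ℝ)⁻¹ * ∑ η,
                  (‖covDstar (torusT (F.P K) 0) (fun κ z => unitsField (toUField W) ⟨z, κ⟩) μ (Ψ η y) z‖ ^ 2
                    + ‖covD (torusT (F.P K) 0) (fun κ z => unitsField (toUField W) ⟨z, κ⟩) μ (Ψ η y) z‖ ^ 2) else 0)
          + 3 * (((F.P K).d : ℝ) * (24 / ((((F.P K).L ^ (K - n) : ℕ) : ℝ)) ^ 2) ^ 2)
            * ∑ y : Site (F.P K) (K - n), ∑ z : Site (F.P K) 0,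
              (if (∀ ν : Fin (F.P K).d,
                  (y ν = (iterBlockOf (K - n) (fun κ => z κ - (((((F.P K).L ^ (K - n) - 1) / 2 : ℕ)) : ZMod ((F.P K).sitesPerDir 0)))) ν - 1
                  ∨ y ν = (iterBlockOf (K - n) (fun κ => z κ - (((((F.P K).L ^ (K - n) - 1) / 2 : ℕ)) : ZMod ((F.P K).sitesPerDir 0)))) ν
                  ∨ y ν = (iterBlockOf (K - n) (fun κ => z κ - (((((F.P K).L ^ (K - n) - 1) / 2 : ℕ)) : ZMod ((F.P K).sitesPerDir 0)))) ν + 1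
                  ∨ y ν = (iterBlockOf (K - n) (fun κ => z κ - (((((F.P K).L ^ (K - n) - 1) / 2 : ℕ)) : ZMod ((F.P K).sitesPerDir 0)))) ν + 2))
                then ∑ μ : Fin (F.P K).d, ‖(Fintype.card H : ℝ)⁻¹ • ∑ η, Ψ η y z - Z μ z‖ ^ 2 else 0))) := by
  have hc : (0 : ℝ) < Fintype.card H := by exact_mod_cast Fintype.card_pos
  have hΨbar : ∀ y : Site (F.P K) (K - n), (Fintype.card H : ℝ)⁻¹ • ∑ η, Ψ η y (embIter (K - n) y) = ψ (embIter (K - n) y) := by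
    intro y
    rw [Finset.sum_congr rfl (fun η _ => hΨ η y), Finset.sum_const, Finset.card_univ, ← Nat.cast_smul_eq_nsmul ℝ, smul_smul,
      inv_mul_cancel₀ hc.ne', one_smul]
  have main := lemmaH_curved_of_localModels_pt F K n hk hℓ2 W ψ hψ (fun y z => (Fintype.card H : ℝ)⁻¹ • ∑ η, Ψ η y z) hΨbar Z
  refine main.trans (mul_le_mul_of_nonneg_left (mul_le_mul_of_nonneg_left (add_le_add (add_le_add ?_ ?_) le_rfl) (by norm_num)) (by positivity))
  · -- Laplacian group: convexity per site
    refine mul_le_mul_of_nonneg_left (Finset.sum_le_sum fun y _ => Finset.sum_le_sum fun z _ => ?_) (by norm_num)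
    split_ifs with hN
    · exact norm_sq_lap_avg_le (torusT (F.P K) 0) (fun κ z => unitsField (toUField W) ⟨z, κ⟩) (fun η => Ψ η y) z
    · exact le_rfl
  · -- Dirichlet group: convexity per bond
    refine mul_le_mul_of_nonneg_left (Finset.sum_le_sum fun y _ => Finset.sum_le_sum fun z _ => ?_) (by positivity)
    split_ifs with hN
    · refine Finset.sum_le_sum fun μ _ => ?_
      have h1 := norm_sq_covDstar_avg_le (torusT (F.P K) 0) (fun κ z => unitsField (toUField W) ⟨z, κ⟩) (fun η => Ψ η y) μ z
      have h2 := norm_sq_covD_avg_le (torusT (F.P K) 0) (fun κ z => unitsField (toUField W) ⟨z, κ⟩) (fun η => Ψ η y) μ z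
      refine (add_le_add h1 h2).trans (le_of_eq ?_)
      rw [← mul_add, ← Finset.sum_add_distrib]
    · exact le_rfl

end T3

/-! ## §2 Averaged axial families -/

section Axial

variable {H : Type*} [Fintype H] [Nonempty H]

/-- ★★★ **LEMMA-H-CURVED AT AN AVERAGED AXIAL FAMILY, POINTWISE RECENTRING GROUP** (✓ `lemmaH_curved_comb_avg` reshaped: no `G`∕`hG`; third group
`3·(d·(24∕ℓ²)²)·Σ_yΣ_(z:N)Σ_μ‖|H|⁻¹Σ_η R(axialT 𝒲 c^η_y z)⁻¹ m^η_y − Z_μ z‖²`). [cite: Balaban1985UV3, (27) p.263] [cite: Balaban1985BackgroundPropagators, (3.3) p.390, (3.8) p.392] -/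
theorem lemmaH_curved_comb_avg_pt (F : T3Family) (K n : ℕ) (hk : K - n ≤ (F.P K).m + (F.P K).K) (hℓ2 : 2 ≤ (F.P K).L ^ (K - n))
    (W : GaugeField (F.P K) 0 (Matrix.specialUnitaryGroup (Fin 2) ℂ)) (ψ : Site (F.P K) 0 → Matrix (Fin 2) (Fin 2) ℂ)
    (hψ : ∀ x : Site (F.P K) 0, x ∉ Set.range (embIter (K - n)) →
      divB (torusT (F.P K) 0) (fun κ z => unitsField (toUField W) ⟨z, κ⟩) (fun κ y => covD (torusT (F.P K) 0) (fun κ z => unitsField (toUField W) ⟨z, κ⟩) κ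
        (fun z => divB (torusT (F.P K) 0) (fun κ z => unitsField (toUField W) ⟨z, κ⟩)
          (fun ν w => covD (torusT (F.P K) 0) (fun κ z => unitsField (toUField W) ⟨z, κ⟩) ν ψ w) z) y) x = 0)
    (c : H → Site (F.P K) (K - n) → Site (F.P K) 0) (mdat : H → Site (F.P K) (K - n) → Matrix (Fin 2) (Fin 2) ℂ)
    (hinterp : ∀ η y, R (axialT (unitsField (toUField W)) (c η y) (embIter (K - n) y))⁻¹ (mdat η y) = ψ (embIter (K - n) y))
    (hwrap : ∀ (η : H) (y : Site (F.P K) (K - n)) (z : Site (F.P K) 0),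
      (∀ ν : Fin (F.P K).d,
        (y ν = (iterBlockOf (K - n) (fun κ => z κ - (((((F.P K).L ^ (K - n) - 1) / 2 : ℕ)) : ZMod ((F.P K).sitesPerDir 0)))) ν - 1
        ∨ y ν = (iterBlockOf (K - n) (fun κ => z κ - (((((F.P K).L ^ (K - n) - 1) / 2 : ℕ)) : ZMod ((F.P K).sitesPerDir 0)))) ν
        ∨ y ν = (iterBlockOf (K - n) (fun κ => z κ - (((((F.P K).L ^ (K - n) - 1) / 2 : ℕ)) : ZMod ((F.P K).sitesPerDir 0)))) ν + 1
        ∨ y ν = (iterBlockOf (K - n) (fun κ => z κ - (((((F.P K).L ^ (K - n) - 1) / 2 : ℕ)) : ZMod ((F.P K).sitesPerDir 0)))) ν + 2)) →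
      ∀ μ : Fin (F.P K).d, (rel (c η y) z μ + 1) * 2 ≤ ((F.P K).sitesPerDir 0 : ℤ)
        ∧ (rel (c η y) ((torusT (F.P K) 0 μ).symm z) μ + 1) * 2 ≤ ((F.P K).sitesPerDir 0 : ℤ))
    (Z : Fin (F.P K).d → Site (F.P K) 0 → Matrix (Fin 2) (Fin 2) ℂ) :
    (F.L : ℝ) ^ (K - n) * ∑ x : Site (F.P K) 0, ∑ a : Fin 2, ∑ b : Fin 2,
        Complex.normSq ((divB (torusT (F.P K) 0) (fun κ z => unitsField (toUField W) ⟨z, κ⟩)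
          (fun κ y => covD (torusT (F.P K) 0) (fun κ z => unitsField (toUField W) ⟨z, κ⟩) κ ψ y) x) a b)
      ≤ (F.L : ℝ) ^ (K - n) * (2 * (
          3 * ∑ y : Site (F.P K) (K - n), ∑ z : Site (F.P K) 0,
            (if (∀ ν : Fin (F.P K).d,
                (y ν = (iterBlockOf (K - n) (fun κ => z κ - (((((F.P K).L ^ (K - n) - 1) / 2 : ℕ)) : ZMod ((F.P K).sitesPerDir 0)))) ν - 1
                ∨ y ν = (iterBlockOf (K - n) (fun κ => z κ - (((((F.P K).L ^ (K - n) - 1) / 2 : ℕ)) : ZMod ((F.P K).sitesPerDir 0)))) ν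
                ∨ y ν = (iterBlockOf (K - n) (fun κ => z κ - (((((F.P K).L ^ (K - n) - 1) / 2 : ℕ)) : ZMod ((F.P K).sitesPerDir 0)))) ν + 1
                ∨ y ν = (iterBlockOf (K - n) (fun κ => z κ - (((((F.P K).L ^ (K - n) - 1) / 2 : ℕ)) : ZMod ((F.P K).sitesPerDir 0)))) ν + 2))
              then (Fintype.card H : ℝ)⁻¹ * ∑ η, (∑ μ : Fin (F.P K).d,
                      (‖(((holT (unitsField (toUField W)) (c η y) (contourT (c η y) ⟨(torusT (F.P K) 0 μ).symm z, μ⟩))⁻¹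
                            * holT (unitsField (toUField W)) (c η y) (contourT (c η y) ⟨z, μ⟩) : (Matrix (Fin 2) (Fin 2) ℂ)ˣ) : Matrix (Fin 2) (Fin 2) ℂ) * mdat η y
                        - mdat η y * (((holT (unitsField (toUField W)) (c η y) (contourT (c η y) ⟨(torusT (F.P K) 0 μ).symm z, μ⟩))⁻¹
                            * holT (unitsField (toUField W)) (c η y) (contourT (c η y) ⟨z, μ⟩) : (Matrix (Fin 2) (Fin 2) ℂ)ˣ) : Matrix (Fin 2) (Fin 2) ℂ)‖
                        + 2 * ‖((holT (unitsField (toUField W)) (c η y) (contourT (c η y) ⟨(torusT (F.P K) 0 μ).symm z, μ⟩) :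
                                (Matrix (Fin 2) (Fin 2) ℂ)ˣ) : Matrix (Fin 2) (Fin 2) ℂ) - 1‖
                          * ‖((holT (unitsField (toUField W)) (c η y) (contourT (c η y) ⟨(torusT (F.P K) 0 μ).symm z, μ⟩) :
                                (Matrix (Fin 2) (Fin 2) ℂ)ˣ) : Matrix (Fin 2) (Fin 2) ℂ) * mdat η y
                              - mdat η y * ((holT (unitsField (toUField W)) (c η y) (contourT (c η y) ⟨(torusT (F.P K) 0 μ).symm z, μ⟩) :
                                (Matrix (Fin 2) (Fin 2) ℂ)ˣ) : Matrix (Fin 2) (Fin 2) ℂ)‖)) ^ 2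
              else 0)
          + 3 * (2 * ((F.P K).d : ℝ) * (6 / ((((F.P K).L ^ (K - n) : ℕ) : ℝ)))) * (3 / ((((F.P K).L ^ (K - n) : ℕ) : ℝ)))
            * ∑ y : Site (F.P K) (K - n), ∑ z : Site (F.P K) 0,
              (if (∀ ν : Fin (F.P K).d,
                  (y ν = (iterBlockOf (K - n) (fun κ => z κ - (((((F.P K).L ^ (K - n) - 1) / 2 : ℕ)) : ZMod ((F.P K).sitesPerDir 0)))) ν - 1
                  ∨ y ν = (iterBlockOf (K - n) (fun κ => z κ - (((((F.P K).L ^ (K - n) - 1) / 2 : ℕ)) : ZMod ((F.P K).sitesPerDir 0)))) ν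
                  ∨ y ν = (iterBlockOf (K - n) (fun κ => z κ - (((((F.P K).L ^ (K - n) - 1) / 2 : ℕ)) : ZMod ((F.P K).sitesPerDir 0)))) ν + 1
                  ∨ y ν = (iterBlockOf (K - n) (fun κ => z κ - (((((F.P K).L ^ (K - n) - 1) / 2 : ℕ)) : ZMod ((F.P K).sitesPerDir 0)))) ν + 2))
                then ∑ μ : Fin (F.P K).d, (Fintype.card H : ℝ)⁻¹ * ∑ η,
                  (‖((holT (unitsField (toUField W)) (c η y) (contourT (c η y) ⟨(torusT (F.P K) 0 μ).symm z, μ⟩) :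
                        (Matrix (Fin 2) (Fin 2) ℂ)ˣ) : Matrix (Fin 2) (Fin 2) ℂ) * mdat η y
                      - mdat η y * ((holT (unitsField (toUField W)) (c η y) (contourT (c η y) ⟨(torusT (F.P K) 0 μ).symm z, μ⟩) :
                        (Matrix (Fin 2) (Fin 2) ℂ)ˣ) : Matrix (Fin 2) (Fin 2) ℂ)‖ ^ 2
                    + ‖((holT (unitsField (toUField W)) (c η y) (contourT (c η y) ⟨z, μ⟩) :
                        (Matrix (Fin 2) (Fin 2) ℂ)ˣ) : Matrix (Fin 2) (Fin 2) ℂ) * mdat η y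
                      - mdat η y * ((holT (unitsField (toUField W)) (c η y) (contourT (c η y) ⟨z, μ⟩) :
                        (Matrix (Fin 2) (Fin 2) ℂ)ˣ) : Matrix (Fin 2) (Fin 2) ℂ)‖ ^ 2) else 0)
          + 3 * (((F.P K).d : ℝ) * (24 / ((((F.P K).L ^ (K - n) : ℕ) : ℝ)) ^ 2) ^ 2)
            * ∑ y : Site (F.P K) (K - n), ∑ z : Site (F.P K) 0,
              (if (∀ ν : Fin (F.P K).d,
                  (y ν = (iterBlockOf (K - n) (fun κ => z κ - (((((F.P K).L ^ (K - n) - 1) / 2 : ℕ)) : ZMod ((F.P K).sitesPerDir 0)))) ν - 1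
                  ∨ y ν = (iterBlockOf (K - n) (fun κ => z κ - (((((F.P K).L ^ (K - n) - 1) / 2 : ℕ)) : ZMod ((F.P K).sitesPerDir 0)))) ν
                  ∨ y ν = (iterBlockOf (K - n) (fun κ => z κ - (((((F.P K).L ^ (K - n) - 1) / 2 : ℕ)) : ZMod ((F.P K).sitesPerDir 0)))) ν + 1
                  ∨ y ν = (iterBlockOf (K - n) (fun κ => z κ - (((((F.P K).L ^ (K - n) - 1) / 2 : ℕ)) : ZMod ((F.P K).sitesPerDir 0)))) ν + 2))
                then ∑ μ : Fin (F.P K).d, ‖(Fintype.card H : ℝ)⁻¹ • ∑ η, R (axialT (unitsField (toUField W)) (c η y) z)⁻¹ (mdat η y) - Z μ z‖ ^ 2 else 0))) := by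
  have hc : (0 : ℝ) ≤ (Fintype.card H : ℝ)⁻¹ := by positivity
  have hV : ∀ b : PBond (F.P K) 0, ‖((unitsField (toUField W) b : (Matrix (Fin 2) (Fin 2) ℂ)ˣ) : Matrix (Fin 2) (Fin 2) ℂ)‖ ≤ 1
      ∧ ‖(((unitsField (toUField W) b)⁻¹ : (Matrix (Fin 2) (Fin 2) ℂ)ˣ) : Matrix (Fin 2) (Fin 2) ℂ)‖ ≤ 1 :=
    fun b => bicontr_of_mem_unitary _ (unitsField_toUField_mem_unitary W b.dir b.src)
  have main := lemmaH_curved_of_localModels_avg_pt F K n hk hℓ2 W ψ hψ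
    (fun η y z => R (axialT (unitsField (toUField W)) (c η y) z)⁻¹ (mdat η y)) hinterp Z
  refine main.trans (mul_le_mul_of_nonneg_left (mul_le_mul_of_nonneg_left (add_le_add (add_le_add ?_ ?_) le_rfl) (by norm_num)) (by positivity))
  · refine mul_le_mul_of_nonneg_left (Finset.sum_le_sum fun y _ => Finset.sum_le_sum fun z _ => ?_) (by norm_num)
    split_ifs with hN
    · refine mul_le_mul_of_nonneg_left (Finset.sum_le_sum fun η _ => ?_) hc
      exact pow_le_pow_left₀ (norm_nonneg _) (norm_lap_axialModel_le (unitsField (toUField W)) hV (c η y) (mdat η y) z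
        (fun μ => (hwrap η y z hN μ).1) (fun μ => (hwrap η y z hN μ).2)) 2
    · exact le_rfl
  · refine mul_le_mul_of_nonneg_left (Finset.sum_le_sum fun y _ => Finset.sum_le_sum fun z _ => ?_) (by positivity)
    split_ifs with hN
    · refine Finset.sum_le_sum fun μ _ => mul_le_mul_of_nonneg_left (Finset.sum_le_sum fun η _ => add_le_add ?_ ?_) hc
      · exact pow_le_pow_left₀ (norm_nonneg _) (norm_covDstar_axialModel_le (unitsField (toUField W)) hV (c η y) (mdat η y) μ z (hwrap η y z hN μ).2) 2
      · exact pow_le_pow_left₀ (norm_nonneg _) (norm_covD_axialModel_le (unitsField (toUField W)) hV (c η y) (mdat η y) μ z (hwrap η y z hN μ).1) 2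
    · exact le_rfl

end Axial

end Summit.QuantumFields.YangMills.Theorems.Prop7LocalModelAveragePt

end
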